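import Literature.Topology.FourManifolds.ClosedModelRelOrientation
import Literature.AlgebraicTopology.SingularHomology.OnePointCollapse
import Literature.AlgebraicTopology.SingularHomology.BoundaryClassNaturality
import Literature.Topology.FourManifolds.BCSBoundaryOrientation
import HarnessLib

/-!
# Collapsing the closed model of a glued manifold onto the closed model of a summand

M. Kervaire, J. Milnor, *Groups of homotopy spheres I*, Ann. of Math. 77 (1963), §2, p. 508 and
§7, footnote pp. 528–529: signatures are computed on the closed homology manifolds
`Ŵ = W ∪ cone(bW)`; for a boundary connected sum `W = W₁ ♮ W₂` the interior of each summand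
`Wᵢ` embeds openly in the interior of `W`, and collapsing the complement of this copy of
`int Wᵢ` to the cone point gives a map `πᵢ : Ŵ → Ŵᵢ` (the Pontryagin–Thom collapse,
`OnePoint.collapse`). This file constructs `πᵢ` from an open embedding of interiors and proves
that it carries the fundamental class `[Ŵ]` of the glued relative fundamental class to `[Ŵᵢ]`:

* `NullCobordism.closedModelTransfer e he` — the collapse `Ŵ_U → Ŵ_P` attached to an open
  embedding `e : int W_P → int W_U`; it is `ofInterior y ↤ ofInterior (e y)` on the embedded copy
  (`closedModelTransfer_ofInterior_apply`) and `∞` elsewhere;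
* `NullCobordism.map_closedModelTransfer_closedModelClass` — if the local classes of `[Ŵ_U]` at
  `e y` and of `[Ŵ_P]` at `y` come from one class on `int W_P` (as produced by the homological
  gluing `BCSGluing.exists_isRelFundamentalClass`), then `(π_P)_* [Ŵ_U] = [Ŵ_P]` — compare local
  classes at every finite point (`toLocal` is natural, the preimage of a finite point is a single
  point where `π_P` is a local homeomorphism) and conclude by
  `eq_zero_of_forall_toLocal_eq_zero_of_ne_infty`.

Everything is proved; no named facts.

## References

* M. A. Kervaire, J. W. Milnor, *Groups of homotopy spheres: I*, Ann. of Math. (2) 77 (1963),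
  504–537, §2 p. 508 and §7 footnote pp. 528–529. [KervaireMilnorAnnals1963]
* J. Milnor, *Topology from the Differentiable Viewpoint*, 1965, §7 (collapse). [MilnorTDV1965]
-/

noncomputable section

open scoped Manifold ContDiff Topology
open Set Function CategoryTheory CategoryTheory.Limits Topology TopologicalSpace
open Literature.AlgebraicTopology.SingularHomology

namespace Literature.Topology.FourManifolds

namespace NullCobordism

variable {m : ℕ}
variable {MP : Type} [TopologicalSpace MP] [ChartedSpace (EuclideanSpace ℝ (Fin (m + 1))) MP]
  [IsManifold (𝓡 (m + 1)) ∞ MP] [CompactSpace MP] [Nonempty MP] [T2Space MP]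
variable {MU : Type} [TopologicalSpace MU] [ChartedSpace (EuclideanSpace ℝ (Fin (m + 1))) MU]
  [IsManifold (𝓡 (m + 1)) ∞ MU] [CompactSpace MU] [Nonempty MU] [T2Space MU]
variable (cP : NullCobordism (m + 1) MP) (cU : NullCobordism (m + 1) MU)

/-! ### The collapse attached to an open embedding of interiors -/

/-- The inclusion of the interior into the closed model, as a continuous map. [folklore] -/
abbrev ofInteriorCM (c : NullCobordism (m + 1) MP) :
    C(ManifoldInterior (m + 1) c.W, ClosedModel (m + 1) c.W) :=
  ⟨ClosedModel.ofInterior, OnePoint.continuous_coe⟩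

omit [IsManifold (𝓡 (m + 1)) ∞ MP] [CompactSpace MP] [Nonempty MP] [T2Space MP] in
/-- The inclusion of the interior into the closed model is an open embedding. [folklore] -/
theorem isOpenEmbedding_ofInteriorCM (c : NullCobordism (m + 1) MP) :
    IsOpenEmbedding (ofInteriorCM c) := OnePoint.isOpenEmbedding_coe

variable {cP cU}
variable (e : C(ManifoldInterior (m + 1) cP.W, ManifoldInterior (m + 1) cU.W)) (he : IsOpenEmbedding e)

/-- The embedded copy of `int W_P` inside `Ŵ_U`. [folklore] -/
def transferSet : Set (ClosedModel (m + 1) cU.W) := range ((ofInteriorCM cU).comp e)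

omit [IsManifold (𝓡 (m + 1)) ∞ MP] [CompactSpace MP] [Nonempty MP] [T2Space MP]
  [IsManifold (𝓡 (m + 1)) ∞ MU] [CompactSpace MU] [Nonempty MU] [T2Space MU] in
include he in
/-- `ofInterior ∘ e` is an open embedding `int W_P → Ŵ_U`. [folklore] -/
theorem isOpenEmbedding_ofInterior_comp : IsOpenEmbedding ((ofInteriorCM cU).comp e) :=
  (isOpenEmbedding_ofInteriorCM cU).comp he

omit [IsManifold (𝓡 (m + 1)) ∞ MP] [CompactSpace MP] [Nonempty MP] [T2Space MP]
  [IsManifold (𝓡 (m + 1)) ∞ MU] [CompactSpace MU] [Nonempty MU] [T2Space MU] in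
include he in
/-- The embedded copy is open. [folklore] -/
theorem isOpen_transferSet : IsOpen (transferSet e) :=
  (isOpenEmbedding_ofInterior_comp e he).isOpen_range

/-- The identification of the embedded copy with `int W_P`. [folklore] -/
def transferHomeo : ↥(transferSet e) ≃ₜ ManifoldInterior (m + 1) cP.W :=
  (isOpenEmbedding_ofInterior_comp e he).isEmbedding.toHomeomorph.symm

omit [IsManifold (𝓡 (m + 1)) ∞ MP] [CompactSpace MP] [Nonempty MP] [T2Space MP]
  [IsManifold (𝓡 (m + 1)) ∞ MU] [CompactSpace MU] [Nonempty MU] [T2Space MU] in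
/-- The identification sends `ofInterior (e y)` to `y`. [folklore] -/
theorem transferHomeo_apply_mk (y : ManifoldInterior (m + 1) cP.W) :
    transferHomeo e he ⟨ClosedModel.ofInterior (e y), ⟨y, rfl⟩⟩ = y :=
  (Homeomorph.symm_apply_eq _).2 (Subtype.ext rfl)

/-- **The collapse `π_P : Ŵ_U → Ŵ_P`** attached to the open embedding `e : int W_P → int W_U`:
`ofInterior (e y) ↦ ofInterior y`, everything else `↦ ∞` (Milnor 1965, §7; here between the
closed models `W ∪ cone(bW)` of Kervaire–Milnor 1963, §7). [cite: MilnorTDV1965, §7] -/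
def closedModelTransfer : C(ClosedModel (m + 1) cU.W, ClosedModel (m + 1) cP.W) :=
  OnePoint.collapseCM (isOpen_transferSet e he) (transferHomeo e he)

omit [IsManifold (𝓡 (m + 1)) ∞ MP] [CompactSpace MP] [Nonempty MP] [T2Space MP]
  [IsManifold (𝓡 (m + 1)) ∞ MU] [CompactSpace MU] [Nonempty MU] [T2Space MU] in
/-- The collapse on the embedded copy. [folklore] -/
@[simp] theorem closedModelTransfer_ofInterior_apply (y : ManifoldInterior (m + 1) cP.W) :
    closedModelTransfer e he (ClosedModel.ofInterior (e y)) = ClosedModel.ofInterior y := by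
  have h1 := OnePoint.collapse_apply_of_mem (transferSet e) (transferHomeo e he)
    (x := ClosedModel.ofInterior (e y)) ⟨y, rfl⟩
  rw [transferHomeo_apply_mk] at h1
  exact h1

omit [IsManifold (𝓡 (m + 1)) ∞ MP] [CompactSpace MP] [Nonempty MP] [T2Space MP]
  [IsManifold (𝓡 (m + 1)) ∞ MU] [CompactSpace MU] [Nonempty MU] [T2Space MU] in
/-- The collapse off the embedded copy. [folklore] -/
theorem closedModelTransfer_apply_of_not_mem {x : ClosedModel (m + 1) cU.W} (hx : x ∉ transferSet e) :
    closedModelTransfer e he x = ClosedModel.infty :=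
  OnePoint.collapse_apply_of_not_mem _ _ hx

omit [IsManifold (𝓡 (m + 1)) ∞ MP] [CompactSpace MP] [Nonempty MP] [T2Space MP]
  [IsManifold (𝓡 (m + 1)) ∞ MU] [CompactSpace MU] [Nonempty MU] [T2Space MU] in
/-- Finite points of `Ŵ_P` have a unique preimage: the collapse is a map of pairs
`(Ŵ_U, Ŵ_U ∖ e y) → (Ŵ_P, Ŵ_P ∖ y)`. [folklore] -/
theorem mapsTo_closedModelTransfer (y : ManifoldInterior (m + 1) cP.W) :
    MapsTo (closedModelTransfer e he) ({ClosedModel.ofInterior (e y)}ᶜ : Set _)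
      ({ClosedModel.ofInterior y}ᶜ : Set _) := by
  have h := OnePoint.mapsTo_collapse_compl_singleton (transferHomeo e he).injective
    ⟨ClosedModel.ofInterior (e y), ⟨y, rfl⟩⟩
  rw [transferHomeo_apply_mk] at h
  exact h

/-! ### Transfer of the fundamental class -/

omit [T2Space MP] [IsManifold (𝓡 (m + 1)) ∞ MU] [CompactSpace MU] [Nonempty MU] [T2Space MU] in
/-- **`(π_P)_* [Ŵ_U] = [Ŵ_P]`** (Kervaire–Milnor 1963, §2 p. 508: the signature of `W₁ ♮ W₂` is
computed summand by summand). If the local classes of the closed-model classes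
`[Ŵ_U] = c_{w_U}` at `e y` and `[Ŵ_P] = c_{w_P}` at `y` come from one class on `int W_P` for every
`y` — which is what the homological gluing of the relative fundamental classes provides — then
the collapse carries `[Ŵ_U]` to `[Ŵ_P]`: their local classes agree at every finite point of `Ŵ_P`
(naturality of `toLocal` for the map of pairs `(Ŵ_U, Ŵ_U ∖ e y) → (Ŵ_P, Ŵ_P ∖ y)` and
`π_P ∘ ofInterior ∘ e = ofInterior`), so the difference vanishes
(`eq_zero_of_forall_toLocal_eq_zero_of_ne_infty`). [cite: KervaireMilnorAnnals1963, §2 p. 508] -/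
theorem map_closedModelTransfer_closedModelClass
    (wP : relativeSingularHomology ℤ ℤ cP.W ((𝓡∂ (m + 1 + 1)).boundary cP.W) (m + 1 + 1))
    (wU : relativeSingularHomology ℤ ℤ cU.W ((𝓡∂ (m + 1 + 1)).boundary cU.W) (m + 1 + 1))
    (hloc : ∀ y : ManifoldInterior (m + 1) cP.W,
      ∃ ζ : localHomology ℤ ℤ (ManifoldInterior (m + 1) cP.W) y (m + 1 + 1),
        singularHomology.toLocal ℤ ℤ (ClosedModel.ofInterior (e y)) (m + 1 + 1)
            (cU.closedModelClass ℤ ℤ (Nat.le_add_left 1 m) wU) =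
          relativeSingularHomology.map ℤ ℤ ((ofInteriorCM cU).comp e)
            (LocalFamily.mapsTo_compl_pt (isOpenEmbedding_ofInterior_comp e he).injective y)
            (m + 1 + 1) ζ ∧
        singularHomology.toLocal ℤ ℤ (ClosedModel.ofInterior y) (m + 1 + 1)
            (cP.closedModelClass ℤ ℤ (Nat.le_add_left 1 m) wP) =
          relativeSingularHomology.map ℤ ℤ (ofInteriorCM cP)
            (LocalFamily.mapsTo_compl_pt (isOpenEmbedding_ofInteriorCM cP).injective y)
            (m + 1 + 1) ζ) :
    singularHomology.map ℤ ℤ (closedModelTransfer e he) (m + 1 + 1)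
        (cU.closedModelClass ℤ ℤ (Nat.le_add_left 1 m) wU) =
      cP.closedModelClass ℤ ℤ (Nat.le_add_left 1 m) wP := by
  obtain ⟨κ⟩ := BoundaryData.nonempty_collar_of_compactSpace m cP.W cP.boundaryData
  rw [← sub_eq_zero]
  apply cP.eq_zero_of_forall_toLocal_eq_zero_of_ne_infty κ ℤ ℤ
  intro x hx
  induction x using OnePoint.rec with
  | infty => exact absurd rfl hx
  | coe y =>
    obtain ⟨ζ, h₁, h₂⟩ := hloc y
    rw [map_sub, sub_eq_zero]
    change singularHomology.toLocal ℤ ℤ (ClosedModel.ofInterior y) (m + 1 + 1) _ =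
      singularHomology.toLocal ℤ ℤ (ClosedModel.ofInterior y) (m + 1 + 1) _
    rw [singularHomology.toLocal_map_apply' ℤ ℤ (closedModelTransfer e he) (ClosedModel.ofInterior (e y))
      (ClosedModel.ofInterior y) (mapsTo_closedModelTransfer e he y), h₁, h₂]
    have hcomp : (closedModelTransfer e he).comp ((ofInteriorCM cU).comp e) = ofInteriorCM cP := by
      ext y' : 1
      exact closedModelTransfer_ofInterior_apply e he y'
    have hc := relativeSingularHomology.map_comp ℤ ℤ ((ofInteriorCM cU).comp e) (closedModelTransfer e he)
      (LocalFamily.mapsTo_compl_pt (isOpenEmbedding_ofInterior_comp e he).injective y)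
      (mapsTo_closedModelTransfer e he y) (m + 1 + 1)
    have hc' := relativeSingularHomology.map_congr_fun' (R := ℤ) hcomp
      ((mapsTo_closedModelTransfer e he y).comp
        (LocalFamily.mapsTo_compl_pt (isOpenEmbedding_ofInterior_comp e he).injective y))
      (LocalFamily.mapsTo_compl_pt (isOpenEmbedding_ofInteriorCM cP).injective y) (m + 1 + 1)
    exact ((ConcreteCategory.congr_hom hc ζ).symm.trans (ConcreteCategory.congr_hom hc' ζ))

end NullCobordism

end Literature.Topology.FourManifolds
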